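import Summits.CriticalPhenomena.PercolationContinuityZ3.Theorems.PercNearOneGluingNoHeavyQuantSDEC
import HarnessLib

/-!
# QUANT lane R8, T-DEC: the GATED CONVOLUTION SPLITS — `gate_q(μ₁ ∗ μ₂)` is an explicit mixture of the plain convolution of the gated
# factors and of the gated convolution of an EMPTY-FREE law with a co-factor (bookkeeping for `…QuantGatedConvReduction`)

builds on p205010 (kernel theorem, internal audit signed; external expert review pending)

Support file (`--supports stmt-CriticalPhenomena-4575`), QUANT lane typer seat prim-quant-stmt (gen 25), rung R8 of
`run/shared/lean/prim/quant/LADDER.md`.  Two small definitions (`LawDec.posPart`, `LawDec.coPart`), theorems with standard axioms, no sorries.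
Part 1 of 2; part 2 (`…QuantGatedConvReduction`) uses the split to prove `ConvClosedT ∧ GatedConvEmptyFree ⟹ SDECConvClosed`.

THE IDENTITY (typer g25; verified exactly on 200 random instances before typing, `explore/idcheck.py`).  For laws `μ₁`, `μ₂` on `{0..M₁}`,
`{0..M₂}`, a gate `q`, `p := μ₁ 0 ≠ 1` and `a := 1 − q + q·p ≠ 0`, with the EMPTY-FREE PART `posPart μ₁ = μ₁|_{≥1}/(1−p)` and the CO-FACTOR
`coPart μ₁ μ₂ = (μ₂ − p·δ₀)/(1−p)` (a probability law when `p ≤ μ₂ 0`):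
    `gate_q(lconv μ₁ μ₂) = (p/a)·lconv (gate_q μ₁) (gate_q μ₂) + ((1−q)(1−p)/a)·gate_{q(1−p)}(lconv (posPart μ₁) (coPart μ₁ μ₂))`
(`gate_lconv_split`), and the gates match: `gate_{q(1−p)}(posPart μ₁) = gate_q μ₁`, `gate_{q(1−p)}(coPart μ₁ μ₂) = gate_q μ₂` (`gate_posPart`,
`gate_coPart`).  Behind it: with `ν_i = gate_q μ_i`, `gate_q(μ₁ ∗ μ₂) = ν₁ ∗ ν₂ + ((1−q)/q)·(δ₀ − ν₁) ∗ (δ₀ − ν₂)` is affine in `c = (1−q)/q`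
at fixed `(ν₁, ν₂)`; `c = 0` is the plain convolution, the largest admissible `c` makes the factor with the smaller atom at `0` empty-free.

* `lconv_lin_left/right`, `lconv_delta_left/right`, `lconv_comm`, `gate_apply` — bilinearity, units, symmetry of `lconv`; the gate is affine.
* `LawDec.posPart`, `LawDec.coPart`, `gate_posPart`, `gate_coPart`, **`gate_lconv_split`**.
* `sum_mul_le_top_mul` (`mean ≤ M·(1 − μ 0)`), `posPart_laws`, `coPart_laws`, `gate_laws` — law facts (nonnegative, top, mass, mean).

[this work]; `gate`/`lconv`/SDEC: prim-quant-census-2 g53 (this lane).  The gluing rows served [cite: KozmaNitzan2024, Conjecture 3 (p. 15)];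
product measure [cite: Grimmett1999, §1.3 p. 10].
-/

noncomputable section

namespace Summit.CriticalPhenomena.PercolationContinuityZ3.Theorems

namespace Quant

open Finset

namespace LawDec

/-! ### Bookkeeping: bilinearity, units and symmetry of `lconv`; the gate as an affine map -/

/-- `lconv` is linear in its first argument (two terms). [this work] -/
theorem lconv_lin_left (M₁ M₂ : ℕ) (c d : ℝ) (f g μ₂ : ℕ → ℝ) (h : ℕ) :
    lconv M₁ M₂ (fun i => c * f i + d * g i) μ₂ h = c * lconv M₁ M₂ f μ₂ h + d * lconv M₁ M₂ g μ₂ h := by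
  simp only [lconv, Finset.mul_sum, ← Finset.sum_add_distrib]
  refine Finset.sum_congr rfl fun i _ => Finset.sum_congr rfl fun k _ => ?_
  split_ifs <;> ring

/-- `lconv` is linear in its second argument (two terms). [this work] -/
theorem lconv_lin_right (M₁ M₂ : ℕ) (c d : ℝ) (μ₁ f g : ℕ → ℝ) (h : ℕ) :
    lconv M₁ M₂ μ₁ (fun k => c * f k + d * g k) h = c * lconv M₁ M₂ μ₁ f h + d * lconv M₁ M₂ μ₁ g h := by
  simp only [lconv, Finset.mul_sum, ← Finset.sum_add_distrib]
  refine Finset.sum_congr rfl fun i _ => Finset.sum_congr rfl fun k _ => ?_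
  split_ifs <;> ring

/-- `δ₀` is a left unit of `lconv` (for a right factor vanishing above its top). [this work] -/
theorem lconv_delta_left (M₁ M₂ : ℕ) (μ₂ : ℕ → ℝ) (h2M : ∀ h, M₂ < h → μ₂ h = 0) (h : ℕ) :
    lconv M₁ M₂ (fun i => if i = 0 then (1 : ℝ) else 0) μ₂ h = μ₂ h := by
  simp only [lconv]
  rw [Finset.sum_eq_single 0]
  · simp only [if_true, one_mul, zero_add]
    have e : ∀ k : ℕ, (if k = h then μ₂ k else 0) = μ₂ h * (if h = k then (1 : ℝ) else 0) := by
      intro k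
      by_cases hk : k = h
      · subst hk; simp
      · rw [if_neg hk, if_neg (Ne.symm hk), mul_zero]
    simp_rw [e]
    rw [← Finset.mul_sum]
    have := sum_indicator (fun _ => (1 : ℝ)) (M₂ + 1) h
    simp only [one_mul] at this
    rw [this]
    split_ifs with hh
    · rw [mul_one]
    · rw [mul_zero]; exact (h2M h (by omega)).symm
  · intro i _ hi0
    refine Finset.sum_eq_zero fun k _ => ?_
    rw [if_neg hi0]
    split_ifs <;> simp
  · intro h0; exact absurd (Finset.mem_range.2 (Nat.succ_pos M₁)) h0

/-- `lconv` is symmetric. [this work] -/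
theorem lconv_comm (M₁ M₂ : ℕ) (μ₁ μ₂ : ℕ → ℝ) : lconv M₁ M₂ μ₁ μ₂ = lconv M₂ M₁ μ₂ μ₁ := by
  funext h
  simp only [lconv]
  rw [Finset.sum_comm]
  refine Finset.sum_congr rfl fun k _ => Finset.sum_congr rfl fun i _ => ?_
  by_cases hik : i + k = h
  · rw [if_pos hik, if_pos (by omega), mul_comm]
  · rw [if_neg hik, if_neg (by omega)]

/-- `δ₀` is a right unit of `lconv` (for a left factor vanishing above its top). [this work] -/
theorem lconv_delta_right (M₁ M₂ : ℕ) (μ₁ : ℕ → ℝ) (h1M : ∀ h, M₁ < h → μ₁ h = 0) (h : ℕ) :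
    lconv M₁ M₂ μ₁ (fun k => if k = 0 then (1 : ℝ) else 0) h = μ₁ h := by
  rw [lconv_comm]; exact lconv_delta_left M₂ M₁ μ₁ h1M h

/-- the gate is the affine map `μ ↦ q·μ + (1−q)·δ₀`. [this work] -/
theorem gate_apply (μ : ℕ → ℝ) (q : ℝ) (h : ℕ) :
    gate μ q h = q * μ h + (1 - q) * (if h = 0 then (1 : ℝ) else 0) := by
  simp only [gate]
  split_ifs <;> ring

/-! ### The split at the empty-free endpoint -/

/-- the EMPTY-FREE PART of a law: `μ` conditioned on `{h ≥ 1}`, `h ↦ [h ≠ 0]·μ h/(1 − μ 0)`. [this work] -/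
def posPart (μ : ℕ → ℝ) : ℕ → ℝ := fun h => if h = 0 then 0 else μ h / (1 - μ 0)

/-- the CO-FACTOR of the split: `(μ₂ − μ₁(0)·δ₀)/(1 − μ₁ 0)` (a probability law when `μ₁ 0 ≤ μ₂ 0 < 1`). [this work] -/
def coPart (μ₁ μ₂ : ℕ → ℝ) : ℕ → ℝ := fun h => if h = 0 then (μ₂ 0 - μ₁ 0) / (1 - μ₁ 0) else μ₂ h / (1 - μ₁ 0)

/-- **the gated empty-free part**: for `p = μ₁ 0 ≠ 1`, `gate_{q(1−p)} (posPart μ₁) = gate_q μ₁`. [this work] -/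
theorem gate_posPart (μ₁ : ℕ → ℝ) (q : ℝ) (hp : μ₁ 0 ≠ 1) :
    gate (posPart μ₁) (q * (1 - μ₁ 0)) = gate μ₁ q := by
  have h1p : 1 - μ₁ 0 ≠ 0 := sub_ne_zero.2 (Ne.symm hp)
  funext h
  rw [gate_apply, gate_apply]
  simp only [posPart]
  by_cases h0 : h = 0
  · subst h0; simp only [if_true]; ring
  · simp only [if_neg h0, mul_zero, add_zero]; field_simp

/-- **the gated co-factor**: for `p = μ₁ 0 ≠ 1`, `gate_{q(1−p)} (coPart μ₁ μ₂) = gate_q μ₂`. [this work] -/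
theorem gate_coPart (μ₁ μ₂ : ℕ → ℝ) (q : ℝ) (hp : μ₁ 0 ≠ 1) :
    gate (coPart μ₁ μ₂) (q * (1 - μ₁ 0)) = gate μ₂ q := by
  have h1p : 1 - μ₁ 0 ≠ 0 := sub_ne_zero.2 (Ne.symm hp)
  funext h
  rw [gate_apply, gate_apply]
  simp only [coPart]
  by_cases h0 : h = 0
  · subst h0; simp only [if_true]; field_simp; ring
  · simp only [if_neg h0, mul_zero, add_zero]; field_simp

/-- **THE SPLIT IDENTITY.**  `μ₁`, `μ₂` vanishing above `M₁`, `M₂`, `p := μ₁ 0 ≠ 1`, `a := 1 − q + q·p ≠ 0`: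
`gate_q(lconv μ₁ μ₂) = (p/a)·lconv (gate_q μ₁) (gate_q μ₂) + ((1−q)(1−p)/a)·gate_{q(1−p)}(lconv (posPart μ₁) (coPart μ₁ μ₂))`
pointwise. [this work] -/
theorem gate_lconv_split (M₁ M₂ : ℕ) (μ₁ μ₂ : ℕ → ℝ) (q : ℝ) (h1M : ∀ h, M₁ < h → μ₁ h = 0) (h2M : ∀ h, M₂ < h → μ₂ h = 0)
    (hp : μ₁ 0 ≠ 1) (ha : 1 - q + q * μ₁ 0 ≠ 0) (h : ℕ) :
    gate (lconv M₁ M₂ μ₁ μ₂) q h =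
      (μ₁ 0 / (1 - q + q * μ₁ 0)) * lconv M₁ M₂ (gate μ₁ q) (gate μ₂ q) h +
      ((1 - q) * (1 - μ₁ 0) / (1 - q + q * μ₁ 0)) * gate (lconv M₁ M₂ (posPart μ₁) (coPart μ₁ μ₂)) (q * (1 - μ₁ 0)) h := by
  have h1p : 1 - μ₁ 0 ≠ 0 := sub_ne_zero.2 (Ne.symm hp)
  -- the two factors as affine combinations of `δ₀` and the transformed laws
  have e1 : μ₁ = fun i => μ₁ 0 * (if i = 0 then (1 : ℝ) else 0) + (1 - μ₁ 0) * posPart μ₁ i := by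
    funext i
    simp only [posPart]
    by_cases hi : i = 0
    · subst hi; simp
    · simp only [if_neg hi, mul_zero, zero_add]; field_simp
  have e2 : μ₂ = fun k => μ₁ 0 * (if k = 0 then (1 : ℝ) else 0) + (1 - μ₁ 0) * coPart μ₁ μ₂ k := by
    funext k
    simp only [coPart]
    by_cases hk : k = 0
    · subst hk; simp only [if_true]; field_simp; ring
    · simp only [if_neg hk, mul_zero, zero_add]; field_simp
  have g1 : gate μ₁ q = fun i => (1 - q + q * μ₁ 0) * (if i = 0 then (1 : ℝ) else 0) + (q * (1 - μ₁ 0)) * posPart μ₁ i := by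
    funext i; rw [gate_apply]; conv_lhs => rw [e1]
    simp only; ring
  have g2 : gate μ₂ q = fun k => (1 - q + q * μ₁ 0) * (if k = 0 then (1 : ℝ) else 0) + (q * (1 - μ₁ 0)) * coPart μ₁ μ₂ k := by
    funext k; rw [gate_apply]; conv_lhs => rw [e2]
    simp only; ring
  -- vanishing above the tops for the transformed laws and `δ₀`
  have hδM₂ : ∀ t, M₂ < t → (fun s : ℕ => if s = 0 then (1 : ℝ) else 0) t = 0 := fun t ht => by
    simp only; rw [if_neg (by omega)]
  have h1M' : ∀ t, M₁ < t → posPart μ₁ t = 0 := fun t ht => by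
    simp only [posPart]; rw [if_neg (by omega), h1M t ht, zero_div]
  have h2M' : ∀ t, M₂ < t → coPart μ₁ μ₂ t = 0 := fun t ht => by
    simp only [coPart]; rw [if_neg (by omega), h2M t ht, zero_div]
  -- expand the three convolutions into the basis `δ₀`, `posPart μ₁`, `coPart μ₁ μ₂`, `C = lconv (posPart μ₁) (coPart μ₁ μ₂)`
  have cδδ := lconv_delta_left M₁ M₂ (fun s : ℕ => if s = 0 then (1 : ℝ) else 0) hδM₂ h
  have cδ2 := lconv_delta_left M₁ M₂ (coPart μ₁ μ₂) h2M' h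
  have c1δ := lconv_delta_right M₁ M₂ (posPart μ₁) h1M' h
  have expand : ∀ α β : ℝ,
      lconv M₁ M₂ (fun i => α * (if i = 0 then (1 : ℝ) else 0) + β * posPart μ₁ i)
        (fun k => α * (if k = 0 then (1 : ℝ) else 0) + β * coPart μ₁ μ₂ k) h
      = α * α * (if h = 0 then (1 : ℝ) else 0) + α * β * coPart μ₁ μ₂ h + β * α * posPart μ₁ h
        + β * β * lconv M₁ M₂ (posPart μ₁) (coPart μ₁ μ₂) h := by
    intro α β
    rw [lconv_lin_left, lconv_lin_right, lconv_lin_right, cδδ, cδ2, c1δ]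
    ring
  have L : gate (lconv M₁ M₂ μ₁ μ₂) q h = q * (μ₁ 0 * μ₁ 0 * (if h = 0 then (1 : ℝ) else 0)
      + μ₁ 0 * (1 - μ₁ 0) * coPart μ₁ μ₂ h + (1 - μ₁ 0) * μ₁ 0 * posPart μ₁ h
      + (1 - μ₁ 0) * (1 - μ₁ 0) * lconv M₁ M₂ (posPart μ₁) (coPart μ₁ μ₂) h)
      + (1 - q) * (if h = 0 then (1 : ℝ) else 0) := by
    rw [gate_apply]
    conv_lhs => rw [e1, e2]
    rw [expand]
  have A : lconv M₁ M₂ (gate μ₁ q) (gate μ₂ q) h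
      = (1 - q + q * μ₁ 0) * (1 - q + q * μ₁ 0) * (if h = 0 then (1 : ℝ) else 0)
      + (1 - q + q * μ₁ 0) * (q * (1 - μ₁ 0)) * coPart μ₁ μ₂ h + (q * (1 - μ₁ 0)) * (1 - q + q * μ₁ 0) * posPart μ₁ h
      + (q * (1 - μ₁ 0)) * (q * (1 - μ₁ 0)) * lconv M₁ M₂ (posPart μ₁) (coPart μ₁ μ₂) h := by
    rw [g1, g2, expand]
  have B : gate (lconv M₁ M₂ (posPart μ₁) (coPart μ₁ μ₂)) (q * (1 - μ₁ 0)) h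
      = q * (1 - μ₁ 0) * lconv M₁ M₂ (posPart μ₁) (coPart μ₁ μ₂) h + (1 - q * (1 - μ₁ 0)) * (if h = 0 then (1 : ℝ) else 0) := by
    rw [gate_apply]
  rw [L, A, B]
  field_simp
  ring

/-! ### Law facts of the transformed pair -/

/-- `Σ h·μ h ≤ M·(1 − μ 0)` for a nonnegative law on `{0..M}` of mass 1. [this work] -/
theorem sum_mul_le_top_mul (M : ℕ) (μ : ℕ → ℝ) (hμ0 : ∀ h, 0 ≤ μ h) (hμ1 : ∑ h ∈ Finset.range (M + 1), μ h = 1) :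
    ∑ h ∈ Finset.range (M + 1), (h : ℝ) * μ h ≤ (M : ℝ) * (1 - μ 0) := by
  calc ∑ h ∈ Finset.range (M + 1), (h : ℝ) * μ h
      ≤ ∑ h ∈ Finset.range (M + 1), ((M : ℝ) * μ h - (M : ℝ) * (if h = 0 then μ h else 0)) := by
        refine Finset.sum_le_sum fun h hh => ?_
        rw [Finset.mem_range] at hh
        by_cases h0 : h = 0
        · subst h0; simp
        · rw [if_neg h0, mul_zero, sub_zero]
          exact mul_le_mul_of_nonneg_right (by exact_mod_cast (by omega : h ≤ M)) (hμ0 h)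
    _ = (M : ℝ) * (1 - μ 0) := by
        rw [Finset.sum_sub_distrib, ← Finset.mul_sum, ← Finset.mul_sum, hμ1, Finset.sum_ite_eq' (Finset.range (M + 1)) 0,
          if_pos (Finset.mem_range.2 (Nat.succ_pos M))]
        ring

/-- laws facts of the empty-free part (`p = μ 0 < 1`): nonnegative, vanishing above `M`, mass `1`, mean `T/(1−p)`, no atom at `0`. [this work] -/
theorem posPart_laws (M : ℕ) (μ : ℕ → ℝ) (hμ0 : ∀ h, 0 ≤ μ h) (hμM : ∀ h, M < h → μ h = 0)
    (hμ1 : ∑ h ∈ Finset.range (M + 1), μ h = 1) (hp : μ 0 < 1) :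
    (∀ h, 0 ≤ posPart μ h) ∧ (∀ h, M < h → posPart μ h = 0) ∧ (∑ h ∈ Finset.range (M + 1), posPart μ h = 1) ∧
      (∑ h ∈ Finset.range (M + 1), (h : ℝ) * posPart μ h = (∑ h ∈ Finset.range (M + 1), (h : ℝ) * μ h) / (1 - μ 0)) ∧
      posPart μ 0 = 0 := by
  have h1p : 0 < 1 - μ 0 := by linarith
  refine ⟨fun h => ?_, fun h hh => ?_, ?_, ?_, by simp [posPart]⟩
  · simp only [posPart]; split_ifs
    · exact le_rfl
    · exact div_nonneg (hμ0 h) h1p.le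
  · simp only [posPart]; rw [if_neg (by omega), hμM h hh, zero_div]
  · have e : ∀ h : ℕ, posPart μ h = μ h / (1 - μ 0) - (if h = 0 then μ h / (1 - μ 0) else 0) := by
      intro h; simp only [posPart]; split_ifs <;> ring
    simp_rw [e]
    rw [Finset.sum_sub_distrib, Finset.sum_ite_eq' (Finset.range (M + 1)) 0, if_pos (Finset.mem_range.2 (Nat.succ_pos M)),
      ← Finset.sum_div, hμ1]
    field_simp
  · have e : ∀ h : ℕ, (h : ℝ) * posPart μ h = ((h : ℝ) * μ h) / (1 - μ 0) := by
      intro h; simp only [posPart]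
      split_ifs with h0
      · rw [h0]; simp
      · ring
    simp_rw [e]
    rw [Finset.sum_div]

/-- laws facts of the co-factor (`p = μ₁ 0 ≤ μ₂ 0`, `p < 1`): nonnegative, vanishing above `M`, mass `1`, mean `T₂/(1−p)`. [this work] -/
theorem coPart_laws (M : ℕ) (μ₁ μ₂ : ℕ → ℝ) (hμ0 : ∀ h, 0 ≤ μ₂ h) (hμM : ∀ h, M < h → μ₂ h = 0)
    (hμ1 : ∑ h ∈ Finset.range (M + 1), μ₂ h = 1) (hp : μ₁ 0 < 1) (hle : μ₁ 0 ≤ μ₂ 0) :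
    (∀ h, 0 ≤ coPart μ₁ μ₂ h) ∧ (∀ h, M < h → coPart μ₁ μ₂ h = 0) ∧ (∑ h ∈ Finset.range (M + 1), coPart μ₁ μ₂ h = 1) ∧
      (∑ h ∈ Finset.range (M + 1), (h : ℝ) * coPart μ₁ μ₂ h = (∑ h ∈ Finset.range (M + 1), (h : ℝ) * μ₂ h) / (1 - μ₁ 0)) := by
  have h1p : 0 < 1 - μ₁ 0 := by linarith
  refine ⟨fun h => ?_, fun h hh => ?_, ?_, ?_⟩
  · simp only [coPart]; split_ifs
    · exact div_nonneg (by linarith) h1p.le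
    · exact div_nonneg (hμ0 h) h1p.le
  · simp only [coPart]; rw [if_neg (by omega), hμM h hh, zero_div]
  · have e : ∀ h : ℕ, coPart μ₁ μ₂ h = μ₂ h / (1 - μ₁ 0) - (if h = 0 then μ₁ 0 / (1 - μ₁ 0) else 0) := by
      intro h; simp only [coPart]
      split_ifs with h0
      · rw [h0]; ring
      · ring
    simp_rw [e]
    rw [Finset.sum_sub_distrib, Finset.sum_ite_eq' (Finset.range (M + 1)) 0, if_pos (Finset.mem_range.2 (Nat.succ_pos M)),
      ← Finset.sum_div, hμ1]
    field_simp
  · have e : ∀ h : ℕ, (h : ℝ) * coPart μ₁ μ₂ h = ((h : ℝ) * μ₂ h) / (1 - μ₁ 0) := by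
      intro h; simp only [coPart]
      split_ifs with h0
      · rw [h0]; simp
      · ring
    simp_rw [e]
    rw [Finset.sum_div]

/-- laws facts of a gated law (`0 ≤ q ≤ 1`): nonnegative, vanishing above `M`, mass `1`. [this work] -/
theorem gate_laws (M : ℕ) (μ : ℕ → ℝ) (q : ℝ) (hq0 : 0 ≤ q) (hq1 : q ≤ 1) (hμ0 : ∀ h, 0 ≤ μ h) (hμM : ∀ h, M < h → μ h = 0)
    (hμ1 : ∑ h ∈ Finset.range (M + 1), μ h = 1) :
    (∀ h, 0 ≤ gate μ q h) ∧ (∀ h, M < h → gate μ q h = 0) ∧ (∑ h ∈ Finset.range (M + 1), gate μ q h = 1) := by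
  refine ⟨fun h => ?_, fun h hh => ?_, sum_gate μ q M hμ1⟩
  · rw [gate_apply]
    have := hμ0 h
    split_ifs <;> nlinarith
  · rw [gate_apply, hμM h hh, if_neg (by omega)]; ring

end LawDec

end Quant

end Summit.CriticalPhenomena.PercolationContinuityZ3.Theorems
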